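import Literature.NumberTheory.EllipticCurves.NewformRankinSelbergTraceFricke
import Literature.NumberTheory.EllipticCurves.AtkinLehnerInvolutionsNewformProofs
import Literature.NumberTheory.EllipticCurves.ModularFormsGamma0Rank
import Literature.NumberTheory.EllipticCurves.NewformPeterssonSizeSymmSquareProofs
import HarnessLib

/-!
# The Rankin–Selberg trace of a newform of squarefree level: Atkin–Lehner cosets and the
# coefficient sequence `rsCoeff N 2 f n = Σ_{c ∣ N, c ∣ n} (c/N) |a_{n/c}|²`

Topic `NumberTheory/EllipticCurves` (modular forms on `Γ₀(N)`); namespace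
`Literature.NumberTheory.EllipticCurves.ModularForms`. Proof file (theorems only; no definition,
no named fact), sequel to `NewformRankinSelbergTraceFricke` (the cusp `0`) and companion of
`NewformPeterssonSizeSiegelProofs` (Siegel's theorem, case A, for the trace zeta function `Z_f`).
For SQUAREFREE `N` (semistable elliptic curves; Frey curves) every cusp `1/c`, `c ∣ N`, of `Γ₀(N)`
is Atkin–Lehner equivalent to `∞`, which makes the `SL₂(ℤ)`-trace `G_f = Σ_{SL₂(ℤ)/Γ₀(N)} |f ∣ A⁻¹|²y²`
(`CuspFormRankinSelbergTrace`, Rankin 1939, §4) completely explicit. We PROVE: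

* `IsNewform0.exists_slash_atkinLehnerSL_apply` — **`(f ∣[2] β(Q))(τ) = (ε_Q/Q) f(τ/Q)`** for a
  newform `f ∈ S₂(Γ₀(N))` and an exact divisor `Q ∥ N`, with the tree's `β(Q) = atkinLehnerSL N Q`
  (`w(Q) = β(Q) diag(Q,1)`, `glCast_atkinLehnerW`) and `ε_Q = ±1`
  (`IsNewform0.exists_atkinLehnerInvolution_eq_smul`, Knapp 1993, Thm. 9.27(b));
* `qExpansion_coeff_eq_zero_of_vadd_periodic` — a `Q`-periodic cusp function has period-`N`
  coefficients supported on the multiples of `N/Q` (geometric sum of roots of unity);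
  `IsNewform0.exists_qExpansion_coeff_slash_atkinLehnerSL` — `c_{cm}(f ∣ β(Q)) = (ε_Q/Q) a_m(f)`,
  `c = N/Q`, and `cₙ = 0` for `c ∤ n`;
* `atkinLehner_coset_injective`, `image_atkinLehner_coset_eq_univ` — for squarefree `N` the cosets
  `(β(N/c) T^j)⁻¹Γ₀(N)`, `c ∣ N`, `0 ≤ j < N/c`, are distinct (the bottom-left entry
  `c(N/c') − c'(cj − cj' + N/c)` of `β(N/c)T^{j−j'}β(N/c')⁻¹`) and exhaust `SL₂(ℤ)/Γ₀(N)`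
  (`Σ_{d ∣ N} d = ∏_{p ∣ N}(p+1) = [SL₂(ℤ) : Γ₀(N)]`, `Nat.sum_divisors`, `gamma0Index`,
  `card_coset_eq_gamma0Index`);
* **`IsNewform0.rsCoeff_eq_sum_divisors_of_squarefree`** —
  `rsCoeff N 2 f n = Σ_{c ∣ N} 𝟙[c ∣ n] (c/N) |a_{n/c}(f)|²`;
* **`IsNewform0.tsum_rsCoeff_div_rpow_of_squarefree`** — for real `w > 2`,
  `Σₙ rsCoeff(n) n^{-w} = (N⁻¹ Σ_{c ∣ N} c^{1−w}) · Σₘ |aₘ(f)|² m^{-w}`: the trace Dirichlet series is an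
  elementary non-vanishing Dirichlet polynomial times the naive Rankin–Selberg series of `f` (so
  the zero-free hypothesis of `IsNewform0.petersson_lower_bound_of_zeroFree` concerns, for
  squarefree `N`, the continuation of `Σ |aₙ|² n^{-w} = ζ⁽ᴺ⁾(w−1)L(Sym² f, w−1)/ζ⁽ᴺ⁾(2w−2) × (p ∣ N
  factors)`, i.e. the classical question of an exceptional zero of `L(s, Sym² f)`).

## References

* [Knapp1993] A. W. Knapp, *Elliptic Curves*, Princeton 1993, (9.62), Lemma 9.24, Thm. 9.27.
* [AtkinLehner1970] A. O. L. Atkin, J. Lehner, Math. Ann. 185 (1970), Thm. 3.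
* [Rankin1939] R. A. Rankin, Proc. Cambridge Philos. Soc. 35 (1939), 357–372, §4.
-/

noncomputable section

namespace Literature.NumberTheory.EllipticCurves.ModularForms

open ModularForm CongruenceSubgroup Complex Filter Set
open _root_.MeasureTheory intervalIntegral
open UpperHalfPlane hiding I
open scoped MatrixGroups ModularForm Topology

/-! ### The Atkin–Lehner cosets: `f ∣ β(Q) = (ε_Q/Q) f(·/Q)` -/

section AtkinLehnerSlash

variable {N : ℕ} [NeZero N]

/-- **`f ∣[2] β(Q) = (ε_Q/Q) f(·/Q)` for a newform** `f ∈ S₂(Γ₀(N))` and an exact divisor `Q ∥ N`,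
where `β(Q) = (x y; N/Q Q) ∈ SL₂(ℤ)` is the tree's `atkinLehnerSL N Q` (so that
`w(Q) = β(Q) diag(Q, 1)`, `glCast_atkinLehnerW`) and `ε_Q = ±1` the Atkin–Lehner eigenvalue
(`IsNewform0.exists_atkinLehnerInvolution_eq_smul`; Knapp 1993, Thm. 9.27(b)). For `Q = N` this is
the Fricke identity `(f ∣ S)(τ) = (ε/N) f(τ/N)` of `IsNewform0.exists_slash_S_apply`.
[cite: Knapp1993, Thm. 9.27(b) and (9.62)] -/
theorem IsNewform0.exists_slash_atkinLehnerSL_apply {f : CuspForm (Gamma0 N) 2} (hf : IsNewform0 f)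
    {Q : ℕ} [NeZero Q] (hQN : Q ∣ N) (hc : Nat.Coprime Q (N / Q)) :
    ∃ ε : ℂ, (ε = 1 ∨ ε = -1) ∧ ∀ τ : ℍ,
      (⇑f ∣[(2 : ℤ)] atkinLehnerSL N Q) τ =
        ε / Q * f (UpperHalfPlane.mk ((τ : ℂ) / Q) (im_div_natCast_pos (N := Q) τ)) := by
  obtain ⟨ε, hε, hW⟩ := hf.exists_atkinLehnerInvolution_eq_smul hQN hc
  refine ⟨ε, hε, fun τ ↦ ?_⟩
  have hQ0 : (0 : ℝ) < Q := Nat.cast_pos.mpr (NeZero.pos Q)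
  have hQc : (Q : ℂ) ≠ 0 := by exact_mod_cast (NeZero.ne Q)
  have h := atkinLehnerInvolution_apply_eq_slash N 2 Q hQN hc f
  rw [hW] at h
  have hN : ((Q : ℝ) ^ (1 - ((2 : ℤ) : ℝ) / 2) : ℝ) = 1 := by norm_num
  rw [hN, Complex.ofReal_one, one_smul, glCast_atkinLehnerW N Q, SlashAction.slash_mul] at h
  set σ : ℍ := UpperHalfPlane.mk ((τ : ℂ) / Q) (im_div_natCast_pos (N := Q) τ) with hσ
  have hpt : tpD Q • σ = τ := by
    refine UpperHalfPlane.ext ?_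
    rw [coe_tpD_smul Q]
    show (Q : ℂ) * ((τ : ℂ) / Q) = τ
    field_simp
  have hτ : ε * f σ = (Q : ℂ) * (⇑f ∣[(2 : ℤ)] atkinLehnerSL N Q) τ := by
    have h1 : (⇑(ε • f) : ℍ → ℂ) σ = ε * f σ := by simp
    rw [← h1, congr_fun h σ, slash_tpD_apply Q, hpt]
    norm_num
    exact Or.inl rfl
  field_simp
  rw [mul_comm, ← hτ]

end AtkinLehnerSlash

/-! ### Period-`N` coefficients of a `Q`-periodic cusp function and of `f ∣ β(Q)` -/

section Coefficients

variable {N : ℕ} [NeZero N]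

/-- **A `Q`-periodic cusp function has period-`N` coefficients supported on the multiples of
`c = N/Q`**: if `φ(τ + Q) = φ(τ)` and `cQ = N` then `cₙ(φ) = 0` unless `c ∣ n` (the Fourier
coefficient over a period `N` is `Σ_{r<c} e^{-2πinr/c}` times the integral over `[0, Q]`, and the
geometric sum vanishes). [folklore] -/
theorem qExpansion_coeff_eq_zero_of_vadd_periodic {φ : ℍ → ℂ} (hφ : IsCuspFunction N φ) {Q c : ℕ}
    (hcQ : c * Q = N) (hper : ∀ τ : ℍ, φ ((Q : ℝ) +ᵥ τ) = φ τ) {n : ℕ} (hn : ¬ c ∣ n) :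
    (qExpansion (N : ℝ) φ).coeff n = 0 := by
  have hN0 : (0 : ℝ) < N := Nat.cast_pos.mpr (NeZero.pos N)
  have hNne : (N : ℕ) ≠ 0 := NeZero.ne N
  have hc0 : 0 < c := Nat.pos_of_ne_zero fun h ↦ hNne (by rw [← hcQ, h, zero_mul])
  have hQ0 : 0 < Q := Nat.pos_of_ne_zero fun h ↦ hNne (by rw [← hcQ, h, mul_zero])
  have hcr : (c : ℝ) * Q = N := by exact_mod_cast hcQ
  have hcc : (c : ℂ) ≠ 0 := by exact_mod_cast hc0.ne'
  -- the Fourier coefficient at height `1`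
  have e := hφ.fourierCoeffOn_horizontal one_pos (n : ℤ)
  rw [if_pos (Int.natCast_nonneg _), Int.toNat_natCast] at e
  suffices hF : fourierCoeffOn hφ.pos (fun x : ℝ ↦ φ (ofComplex ((x : ℂ) + (1 : ℝ) * I))) (n : ℤ) = 0 by
    rw [hF] at e
    have hexp : (Real.exp (-(2 * Real.pi * n / N) * 1) : ℂ) ≠ 0 := by
      exact_mod_cast (Real.exp_pos _).ne'
    exact (mul_eq_zero.mp e.symm).resolve_right hexp
  rw [fourierCoeffOn_eq_integral]
  set g : ℝ → ℂ := fun x : ℝ ↦ fourier (-(n : ℤ)) (x : AddCircle ((N : ℝ) - 0)) •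
    φ (ofComplex (((x : ℝ) : ℂ) + (1 : ℝ) * I)) with hg
  suffices hI : ∫ x in (0 : ℝ)..(N : ℝ), g x = 0 by
    change (1 / ((N : ℝ) - 0)) • ∫ x in (0 : ℝ)..(N : ℝ), g x = 0
    rw [hI, smul_zero]
  -- the root of unity `ζ = e^{-2πin/c}`
  set ζ : ℂ := Complex.exp (-(2 * Real.pi * I * n / c)) with hζ
  have hζc : ζ ^ c = 1 := by
    rw [hζ, ← Complex.exp_nat_mul, show (c : ℂ) * -(2 * Real.pi * I * n / c) = (-(n : ℤ) : ℤ) * (2 * Real.pi * I) by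
      push_cast; field_simp]
    exact Complex.exp_int_mul_two_pi_mul_I _
  have hζ1 : ζ ≠ 1 := by
    intro h1
    rw [hζ, Complex.exp_eq_one_iff] at h1
    obtain ⟨k, hk⟩ := h1
    have hk' : -(n : ℂ) = k * c := by
      have h2πI : (2 * Real.pi * I : ℂ) ≠ 0 := by simp [Real.pi_pos.ne']
      field_simp at hk
      linear_combination hk
    apply hn
    have hkz : (-(n : ℤ) : ℤ) = k * c := by exact_mod_cast hk'
    have : (c : ℤ) ∣ (n : ℤ) := ⟨-k, by linarith⟩
    exact_mod_cast this
  -- `g(x + Q) = ζ g(x)`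
  have hkey : ∀ x : ℝ, g (x + Q) = ζ * g x := by
    intro x
    simp only [hg, fourier_coe_apply, sub_zero, smul_eq_mul]
    have hz : 0 < ((x : ℂ) + (1 : ℝ) * I).im := by simp
    have hz' : 0 < ((((x + Q : ℝ)) : ℂ) + (1 : ℝ) * I).im := by simp
    have hφp : φ (ofComplex ((((x + Q : ℝ)) : ℂ) + (1 : ℝ) * I)) = φ (ofComplex ((x : ℂ) + (1 : ℝ) * I)) := by
      rw [ofComplex_apply_of_im_pos hz, ofComplex_apply_of_im_pos hz', ← hper ⟨(x : ℂ) + (1 : ℝ) * I, hz⟩]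
      congr 1
      refine UpperHalfPlane.ext ?_
      rw [UpperHalfPlane.coe_vadd]
      show (((x + Q : ℝ)) : ℂ) + (1 : ℝ) * I = ((Q : ℝ) : ℂ) + ((x : ℂ) + (1 : ℝ) * I)
      push_cast; ring
    rw [hφp, ← mul_assoc]
    congr 1
    rw [hζ, ← Complex.exp_add]
    congr 1
    have hNc : (N : ℂ) = c * Q := by exact_mod_cast hcQ.symm
    push_cast
    rw [hNc]
    have hQc : (Q : ℂ) ≠ 0 := by exact_mod_cast hQ0.ne'
    field_simp
    ring
  have hiter : ∀ (r : ℕ) (x : ℝ), g (x + r * Q) = ζ ^ r * g x := by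
    intro r
    induction r with
    | zero => intro x; simp
    | succ r ih =>
      intro x
      rw [show x + ((r + 1 : ℕ) : ℝ) * Q = (x + r * Q) + Q by push_cast; ring, hkey, ih, pow_succ]
      ring
  -- split `[0, N]` into `c` blocks of length `Q`
  have hcont : Continuous g :=
    (((fourier (-(n : ℤ))).continuous.comp (AddCircle.continuous_mk' _))).smul
      (hφ.continuous_horizontal one_pos)
  have hsplit : ∫ x in (0 : ℝ)..N, g x =
      ∑ r ∈ Finset.range c, ∫ x in ((r : ℝ) * Q)..(((r + 1 : ℕ) : ℝ) * Q), g x := by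
    have h := intervalIntegral.sum_integral_adjacent_intervals (a := fun r : ℕ ↦ (r : ℝ) * Q) (n := c)
      (f := g) (μ := volume) (fun r _ ↦ hcont.intervalIntegrable _ _)
    simp only [Nat.cast_zero, zero_mul] at h
    rw [hcr] at h
    rw [← h]
  have hpiece : ∀ r : ℕ, ∫ x in ((r : ℝ) * Q)..(((r + 1 : ℕ) : ℝ) * Q), g x = ζ ^ r * ∫ x in (0 : ℝ)..Q, g x := by
    intro r
    have h := intervalIntegral.integral_comp_add_right (fun x ↦ g x) ((r : ℝ) * Q) (a := 0) (b := Q)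
    rw [zero_add, show (Q : ℝ) + r * Q = ((r + 1 : ℕ) : ℝ) * Q by push_cast; ring] at h
    rw [← h]
    simp_rw [hiter r]
    exact intervalIntegral.integral_const_mul _ _
  rw [hsplit]
  simp_rw [hpiece]
  rw [← Finset.sum_mul, geom_sum_eq hζ1, hζc]
  simp

/-- The horizontal substitution behind the coefficients of `f ∣ β(Q)`: for a `1`-periodic cuspidal
`f`, `cQ = N` and `n = cm`,
`(1/N)∫₀ᴺ e^{-2πinx/N} f(x/Q + i) dx =` the Fourier coefficient `m` of `x ↦ f(x + i)` on `[0,1]`.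
[folklore] -/
theorem fourierCoeffOn_comp_div (f : CuspForm (Gamma0 N) 2) {Q c : ℕ} (hQ0 : 0 < Q) (hcQ : c * Q = N)
    (m : ℕ) :
    fourierCoeffOn (Nat.cast_pos.mpr (NeZero.pos N) : (0 : ℝ) < N)
        (fun x : ℝ ↦ (⇑f) (ofComplex ((((x / Q : ℝ)) : ℂ) + (1 : ℝ) * I))) ((c * m : ℕ) : ℤ) =
      fourierCoeffOn (isCuspFunction_one f).pos
        (fun x : ℝ ↦ (⇑f) (ofComplex ((x : ℂ) + (1 : ℝ) * I))) (m : ℤ) := by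
  have h1f : IsCuspFunction 1 ⇑f := isCuspFunction_one f
  have hN0 : (0 : ℝ) < N := Nat.cast_pos.mpr (NeZero.pos N)
  have hQr : (0 : ℝ) < Q := Nat.cast_pos.mpr hQ0
  have hcr : (c : ℝ) * Q = N := by exact_mod_cast hcQ
  have hc0 : 0 < c := Nat.pos_of_ne_zero fun h ↦ (NeZero.ne N) (by rw [← hcQ, h, zero_mul])
  rw [fourierCoeffOn_eq_integral, fourierCoeffOn_eq_integral]
  set g : ℝ → ℂ := fun u : ℝ ↦ fourier (-(m : ℤ)) (u : AddCircle ((1 : ℝ) - 0)) •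
    (⇑f) (ofComplex (((u : ℝ) : ℂ) + (1 : ℝ) * I)) with hg
  have hi : ∀ x : ℝ, fourier (-((c * m : ℕ) : ℤ)) (x : AddCircle ((N : ℝ) - 0)) •
      (⇑f) (ofComplex ((((x / Q : ℝ)) : ℂ) + (1 : ℝ) * I)) = g (x / Q) := by
    intro x
    simp only [hg, fourier_coe_apply, sub_zero, smul_eq_mul]
    congr 1
    congr 1
    have hNc : (N : ℂ) = c * Q := by exact_mod_cast hcQ.symm
    have hQc : (Q : ℂ) ≠ 0 := by exact_mod_cast hQ0.ne'
    have hcc : (c : ℂ) ≠ 0 := by exact_mod_cast hc0.ne'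
    push_cast
    rw [hNc]
    field_simp
  simp_rw [hi]
  rw [intervalIntegral.integral_comp_div (fun u ↦ g u) hQr.ne', zero_div, sub_zero,
    show (N : ℝ) / Q = (c : ℕ) by rw [← hcr]; field_simp]
  -- `∫₀ᶜ g = c ∫₀¹ g` by `1`-periodicity
  have hgp : Function.Periodic g 1 := by
    intro u
    simp only [hg]
    congr 1
    · rw [sub_zero]
      congr 1
      rw [AddCircle.coe_add, AddCircle.coe_period, add_zero]
    · have := h1f.periodic ((u : ℂ) + (1 : ℝ) * I)
      simp only [Function.comp_apply] at this
      push_cast at this ⊢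
      rw [show (u : ℂ) + 1 + 1 * I = (u : ℂ) + 1 * I + 1 by ring]
      exact this
  have hgc : Continuous g :=
    (((fourier (-(m : ℤ))).continuous.comp (AddCircle.continuous_mk' _))).smul
      (h1f.continuous_horizontal one_pos)
  rw [intervalIntegral_zero_nat_of_periodic hgp hgc c]
  simp only [sub_zero, Complex.real_smul, Complex.ofReal_one, div_one, one_mul]
  have hNc : (N : ℂ) = c * Q := by exact_mod_cast hcQ.symm
  have hQc : (Q : ℂ) ≠ 0 := by exact_mod_cast hQ0.ne'
  have hcc : (c : ℂ) ≠ 0 := by exact_mod_cast hc0.ne'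
  push_cast
  rw [hNc]
  field_simp

/-- **The period-`N` coefficients of `f ∣ β(Q)` at the multiples of `c = N/Q`**: for a newform
`f ∈ S₂(Γ₀(N))`, `cQ = N` with `gcd(Q, c) = 1`, `c_{cm}(f ∣ β(Q)) = (ε_Q/Q) a_m(f)` (and the other
coefficients vanish, `qExpansion_coeff_eq_zero_of_vadd_periodic`, `f ∣ β(Q)` being `Q`-periodic).
[cite: Knapp1993, Thm. 9.27(b)] -/
theorem IsNewform0.exists_qExpansion_coeff_slash_atkinLehnerSL {f : CuspForm (Gamma0 N) 2}
    (hf : IsNewform0 f) {Q c : ℕ} [NeZero Q] (hcQ : c * Q = N) (hcop : Nat.Coprime Q c) :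
    ∃ ε : ℂ, (ε = 1 ∨ ε = -1) ∧
      (∀ τ : ℍ, (⇑f ∣[(2 : ℤ)] atkinLehnerSL N Q) τ =
        ε / Q * f (UpperHalfPlane.mk ((τ : ℂ) / Q) (im_div_natCast_pos (N := Q) τ))) ∧
      (∀ m : ℕ, (qExpansion (N : ℝ) (⇑f ∣[(2 : ℤ)] atkinLehnerSL N Q)).coeff (c * m) =
        ε / Q * cuspCoeff f m) ∧
      (∀ n : ℕ, ¬ c ∣ n → (qExpansion (N : ℝ) (⇑f ∣[(2 : ℤ)] atkinLehnerSL N Q)).coeff n = 0) := by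
  have hQN : Q ∣ N := Dvd.intro_left c hcQ
  have hQ0 : 0 < Q := NeZero.pos Q
  have hNQ : N / Q = c := by rw [← hcQ, Nat.mul_div_cancel _ hQ0]
  have hc' : Nat.Coprime Q (N / Q) := by rwa [hNQ]
  obtain ⟨ε, hε, hS⟩ := hf.exists_slash_atkinLehnerSL_apply hQN hc'
  set F : ℍ → ℂ := ⇑f ∣[(2 : ℤ)] atkinLehnerSL N Q with hFdef
  have hNF : IsCuspFunction N F := isCuspFunction_slash f _
  have h1f : IsCuspFunction 1 ⇑f := isCuspFunction_one f
  have hN0 : (0 : ℝ) < N := Nat.cast_pos.mpr (NeZero.pos N)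
  have hQr : (0 : ℝ) < Q := Nat.cast_pos.mpr hQ0
  have hQc : (Q : ℂ) ≠ 0 := by exact_mod_cast hQ0.ne'
  have hcr : (c : ℝ) * Q = N := by exact_mod_cast hcQ
  -- `F` is `Q`-periodic
  have hper : ∀ τ : ℍ, F ((Q : ℝ) +ᵥ τ) = F τ := by
    intro τ
    set z : ℍ := UpperHalfPlane.mk ((τ : ℂ) / Q) (im_div_natCast_pos (N := Q) τ) with hzdef
    have hpt : UpperHalfPlane.mk ((((Q : ℝ) +ᵥ τ : ℍ) : ℂ) / Q) (im_div_natCast_pos (N := Q) _) =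
        (1 : ℝ) +ᵥ z := by
      refine UpperHalfPlane.ext ?_
      show ((((Q : ℝ) +ᵥ τ : ℍ) : ℂ)) / Q = (((1 : ℝ) +ᵥ z : ℍ) : ℂ)
      rw [UpperHalfPlane.coe_vadd, UpperHalfPlane.coe_vadd]
      show (((Q : ℝ) : ℂ) + (τ : ℂ)) / Q = ((1 : ℝ) : ℂ) + (τ : ℂ) / Q
      push_cast
      field_simp
    have hz1 : 0 < ((z : ℂ) + 1).im := by
      rw [Complex.add_im, Complex.one_im, add_zero]; exact z.im_pos
    have hvadd : (1 : ℝ) +ᵥ z = ofComplex ((z : ℂ) + 1) := by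
      refine UpperHalfPlane.ext ?_
      rw [UpperHalfPlane.coe_vadd, ofComplex_apply_of_im_pos hz1]
      push_cast
      ring
    have hf1 : f ((1 : ℝ) +ᵥ z) = f z := by
      have h2 := h1f.periodic (z : ℂ)
      simp only [Function.comp_apply, ofComplex_apply] at h2
      rw [hvadd]
      exact h2
    rw [hS, hS, hpt, hf1]
  refine ⟨ε, hε, hS, fun m ↦ ?_, fun n hn ↦ qExpansion_coeff_eq_zero_of_vadd_periodic hNF hcQ hper hn⟩
  -- the coefficient at `c m`, at height `Q`
  have eN := hNF.fourierCoeffOn_horizontal hQr ((c * m : ℕ) : ℤ)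
  have e1 := h1f.fourierCoeffOn_horizontal one_pos (m : ℤ)
  rw [if_pos (Int.natCast_nonneg _), Int.toNat_natCast] at eN e1
  have hpt : ∀ x : ℝ, F (ofComplex ((x : ℂ) + (Q : ℝ) * I)) =
      ε / Q * f (ofComplex ((((x / Q : ℝ)) : ℂ) + (1 : ℝ) * I)) := by
    intro x
    have hz : 0 < ((x : ℂ) + (Q : ℝ) * I).im := by simp [hQr]
    have hz' : 0 < ((((x / Q : ℝ)) : ℂ) + (1 : ℝ) * I).im := by simp
    rw [ofComplex_apply_of_im_pos hz, hS, ofComplex_apply_of_im_pos hz']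
    congr 2
    refine UpperHalfPlane.ext ?_
    show ((x : ℂ) + (Q : ℝ) * I) / Q = (((x / Q : ℝ)) : ℂ) + (1 : ℝ) * I
    push_cast
    field_simp
  have hF : fourierCoeffOn hNF.pos (fun x : ℝ ↦ F (ofComplex ((x : ℂ) + (Q : ℝ) * I))) ((c * m : ℕ) : ℤ) =
      ε / Q * fourierCoeffOn h1f.pos (fun x : ℝ ↦ (⇑f) (ofComplex ((x : ℂ) + (1 : ℝ) * I))) (m : ℤ) := by
    have h := fourierCoeffOn_comp_div f hQ0 hcQ m
    simp_rw [hpt]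
    rw [fourierCoeffOn.const_mul]
    congr 1
  rw [hF, e1] at eN
  have hexp : (Real.exp (-(2 * Real.pi * m / 1) * 1) : ℂ) ≠ 0 := by
    exact_mod_cast (Real.exp_pos _).ne'
  have hexp' : (Real.exp (-(2 * Real.pi * ((c * m : ℕ) : ℕ) / N) * Q) : ℂ) =
      (Real.exp (-(2 * Real.pi * m / 1) * 1) : ℂ) := by
    congr 2
    push_cast
    rw [← hcr]
    have hc0 : (c : ℝ) ≠ 0 := by
      have : 0 < c := Nat.pos_of_ne_zero fun h ↦ (NeZero.ne N) (by rw [← hcQ, h, zero_mul])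
      exact_mod_cast this.ne'
    field_simp
  rw [hexp'] at eN
  have key : (qExpansion (N : ℝ) F).coeff (c * m) * (Real.exp (-(2 * Real.pi * m / 1) * 1) : ℂ) =
      (ε / Q * (qExpansion 1 ⇑f).coeff m) * (Real.exp (-(2 * Real.pi * m / 1) * 1) : ℂ) := by
    rw [← eN]; ring
  rw [mul_right_cancel₀ hexp key, cuspCoeff]

end Coefficients

/-! ### The cosets `SL₂(ℤ)/Γ₀(N)` for squarefree `N`: `(β(N/c) T^j)⁻¹ Γ₀(N)`, `c ∣ N`, `0 ≤ j < N/c` -/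

section Cosets

variable {N : ℕ} [NeZero N]

omit [NeZero N] in
/-- For squarefree `N` and `c ∣ N`: `gcd(N/c, c) = 1`. [folklore] -/
theorem coprime_div_of_squarefree (hN : Squarefree N) {c : ℕ} (hc : c ∣ N) : Nat.Coprime (N / c) c := by
  obtain ⟨Q, rfl⟩ := hc
  have hc0 : 0 < c := Nat.pos_of_ne_zero fun h ↦ hN.ne_zero (by rw [h, zero_mul])
  rw [Nat.mul_div_cancel_left _ hc0]
  exact (Nat.coprime_of_squarefree_mul hN).symm

omit [NeZero N] in
/-- `N/(N/c) = c` for `c ∣ N`, `N ≠ 0`. [folklore] -/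
theorem div_div_self_of_dvd (hN0 : N ≠ 0) {c : ℕ} (hc : c ∣ N) : N / (N / c) = c :=
  Nat.div_div_self hc hN0

omit [NeZero N] in
/-- The bottom row of `β(N/c)` is `(c, N/c)` (squarefree `N`, `c ∣ N`). [cite: Knapp1993, (9.62)] -/
theorem atkinLehnerSL_div_apply_one (hN : Squarefree N) {c : ℕ} (hc : c ∣ N) :
    (atkinLehnerSL N (N / c)) 1 0 = (c : ℤ) ∧ (atkinLehnerSL N (N / c)) 1 1 = ((N / c : ℕ) : ℤ) := by
  have hcop : Nat.Coprime (N / c) (N / (N / c)) := by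
    rw [div_div_self_of_dvd hN.ne_zero hc]; exact coprime_div_of_squarefree hN hc
  have h := atkinLehnerSL_apply_one N (N / c) hcop
  rw [div_div_self_of_dvd hN.ne_zero hc] at h
  exact h

omit [NeZero N] in
/-- **The bottom-left entry of `β(N/c) T^m β(N/c')⁻¹` is `c (N/c') − c' (c m + N/c)`**. [folklore] -/
theorem entry_atkinLehnerSL_mul_T_zpow_mul_inv (hN : Squarefree N) {c c' : ℕ} (hc : c ∣ N) (hc' : c' ∣ N)
    (m : ℤ) :
    (atkinLehnerSL N (N / c) * ModularGroup.T ^ m * (atkinLehnerSL N (N / c'))⁻¹ : SL(2, ℤ)) 1 0 =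
      (c : ℤ) * ((N / c' : ℕ) : ℤ) - (c' : ℤ) * ((c : ℤ) * m + ((N / c : ℕ) : ℤ)) := by
  obtain ⟨h10, h11⟩ := atkinLehnerSL_div_apply_one hN hc
  obtain ⟨h10', h11'⟩ := atkinLehnerSL_div_apply_one hN hc'
  set B := atkinLehnerSL N (N / c) with hB
  set B' := atkinLehnerSL N (N / c') with hB'
  have hinv : ((B'⁻¹ : SL(2, ℤ)) : Matrix (Fin 2) (Fin 2) ℤ) = (B' : Matrix (Fin 2) (Fin 2) ℤ).adjugate :=
    Matrix.SpecialLinearGroup.coe_inv B'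
  show ((B * ModularGroup.T ^ m * B'⁻¹ : SL(2, ℤ)) : Matrix (Fin 2) (Fin 2) ℤ) 1 0 = _
  rw [Matrix.SpecialLinearGroup.coe_mul, Matrix.SpecialLinearGroup.coe_mul, hinv, ModularGroup.coe_T_zpow,
    Matrix.adjugate_fin_two]
  simp only [Matrix.mul_apply, Fin.sum_univ_two, Matrix.of_apply, Matrix.cons_val', Matrix.cons_val_zero,
    Matrix.cons_val_one, Matrix.cons_val_fin_one]
  have e10 : (B : Matrix (Fin 2) (Fin 2) ℤ) 1 0 = c := h10
  have e11 : (B : Matrix (Fin 2) (Fin 2) ℤ) 1 1 = ((N / c : ℕ) : ℤ) := h11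
  have e10' : (B' : Matrix (Fin 2) (Fin 2) ℤ) 1 0 = c' := h10'
  have e11' : (B' : Matrix (Fin 2) (Fin 2) ℤ) 1 1 = ((N / c' : ℕ) : ℤ) := h11'
  rw [e10, e11, e10', e11']
  ring

omit [NeZero N] in
/-- **Distinctness of the Atkin–Lehner cosets** (squarefree `N`): if
`(β(N/c) T^j)⁻¹ Γ₀(N) = (β(N/c') T^{j'})⁻¹ Γ₀(N)` with `c, c' ∣ N`, `j < N/c`, `j' < N/c'`, then
`c = c'` and `j = j'` (`c ∣ c'(N/c)` forces `c ∣ c'` by `gcd(c, N/c) = 1`, symmetrically `c' ∣ c`;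
then `N ∣ c²(j − j')` forces `N/c ∣ j − j'`). [folklore] -/
theorem atkinLehner_coset_injective (hN : Squarefree N) {c c' : ℕ} (hc : c ∣ N) (hc' : c' ∣ N) {j j' : ℕ}
    (hj : j < N / c) (hj' : j' < N / c')
    (h : (QuotientGroup.mk ((atkinLehnerSL N (N / c) * ModularGroup.T ^ (j : ℤ))⁻¹) : SL(2, ℤ) ⧸ Gamma0 N) =
      QuotientGroup.mk ((atkinLehnerSL N (N / c') * ModularGroup.T ^ (j' : ℤ))⁻¹)) :
    c = c' ∧ j = j' := by
  have hN0 := hN.ne_zero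
  have hc0 : 0 < c := Nat.pos_of_dvd_of_pos hc (Nat.pos_of_ne_zero hN0)
  have hc0' : 0 < c' := Nat.pos_of_dvd_of_pos hc' (Nat.pos_of_ne_zero hN0)
  have hmem := QuotientGroup.eq.mp h
  rw [inv_inv, mul_inv_rev, ← mul_assoc, mul_assoc (atkinLehnerSL N (N / c)), ← zpow_neg, ← zpow_add,
    ← sub_eq_add_neg, Gamma0_mem, entry_atkinLehnerSL_mul_T_zpow_mul_inv hN hc hc'] at hmem
  rw [ZMod.intCast_zmod_eq_zero_iff_dvd] at hmem
  set m : ℤ := (j : ℤ) - j' with hm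
  set Q : ℕ := N / c with hQ
  set Q' : ℕ := N / c' with hQ'
  have hcQ : c * Q = N := Nat.mul_div_cancel' hc
  have hcQ' : c' * Q' = N := Nat.mul_div_cancel' hc'
  have hcopQ : IsCoprime (c : ℤ) (Q : ℤ) :=
    Nat.isCoprime_iff_coprime.mpr (coprime_div_of_squarefree hN hc).symm
  have hcopQ' : IsCoprime (c' : ℤ) (Q' : ℤ) :=
    Nat.isCoprime_iff_coprime.mpr (coprime_div_of_squarefree hN hc').symm
  -- `c ∣ c'` and `c' ∣ c`
  have hcdvd : (c : ℤ) ∣ (c' : ℤ) := by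
    have h1 : (c : ℤ) ∣ (c : ℤ) * Q' - c' * (c * m + Q) := (Int.natCast_dvd_natCast.mpr hc).trans hmem
    have h2 : (c : ℤ) ∣ (c' : ℤ) * Q := by
      have : (c' : ℤ) * Q = (c * Q' - c' * (c * m + Q)) * (-1) + c * (Q' - c' * m) := by ring
      rw [this]
      exact (h1.mul_right _).add (dvd_mul_right _ _)
    exact hcopQ.dvd_of_dvd_mul_right h2
  have hcdvd' : (c' : ℤ) ∣ (c : ℤ) := by
    have h1 : (c' : ℤ) ∣ (c : ℤ) * Q' - c' * (c * m + Q) := (Int.natCast_dvd_natCast.mpr hc').trans hmem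
    have h2 : (c' : ℤ) ∣ (c : ℤ) * Q' := by
      have : (c : ℤ) * Q' = (c * Q' - c' * (c * m + Q)) + c' * (c * m + Q) := by ring
      rw [this]
      exact h1.add (dvd_mul_right _ _)
    exact hcopQ'.dvd_of_dvd_mul_right h2
  have hcc : c = c' :=
    Nat.dvd_antisymm (Int.natCast_dvd_natCast.mp hcdvd) (Int.natCast_dvd_natCast.mp hcdvd')
  subst hcc
  refine ⟨rfl, ?_⟩
  -- `N ∣ -c² m` gives `Q ∣ m`
  have hQm : (Q : ℤ) ∣ m := by
    have h1 : ((N : ℕ) : ℤ) ∣ (c : ℤ) * ((c : ℤ) * m) := by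
      have : (c : ℤ) * Q - c * (c * m + Q) = -(c * (c * m)) := by ring
      rw [this, dvd_neg] at hmem
      exact hmem
    rw [← hcQ, Nat.cast_mul] at h1
    have h2 : (Q : ℤ) ∣ (c : ℤ) * m :=
      (mul_dvd_mul_iff_left (by exact_mod_cast hc0.ne')).mp h1
    exact hcopQ.symm.dvd_of_dvd_mul_left h2
  have habs : |m| < Q := by
    rw [hm, abs_lt]; constructor <;> omega
  have := Int.eq_zero_of_abs_lt_dvd hQm habs
  omega

/-- **The Atkin–Lehner cosets exhaust `SL₂(ℤ)/Γ₀(N)`** for squarefree `N`: the map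
`(c, j) ↦ (β(N/c) T^j)⁻¹ Γ₀(N)` on `{(c, j) : c ∣ N, 0 ≤ j < N/c}` is injective with
`Σ_{c ∣ N} N/c = Σ_{d ∣ N} d = ∏_{p ∣ N}(p + 1) = [SL₂(ℤ) : Γ₀(N)]` values (`Nat.sum_divisors`,
`gamma0Index`, `card_quotient_eq`). [folklore] -/
theorem image_atkinLehner_coset_eq_univ (hN : Squarefree N) [Fintype (SL(2, ℤ) ⧸ Gamma0 N)]
    [DecidableEq (SL(2, ℤ) ⧸ Gamma0 N)] :
    (N.divisors.sigma fun c ↦ Finset.range (N / c)).image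
        (fun x : (Σ _ : ℕ, ℕ) ↦ (QuotientGroup.mk
          ((atkinLehnerSL N (N / x.1) * ModularGroup.T ^ (x.2 : ℤ))⁻¹) : SL(2, ℤ) ⧸ Gamma0 N)) =
      Finset.univ := by
  have hN0 := hN.ne_zero
  refine Finset.eq_univ_of_card _ ?_
  rw [Finset.card_image_of_injOn, Finset.card_sigma]
  · -- `Σ_{c ∣ N} N/c = gamma0Index N`
    simp_rw [Finset.card_range]
    rw [Nat.sum_div_divisors N (fun d ↦ d), ← Nat.card_eq_fintype_card, card_coset_eq_gamma0Index]
    rw [Nat.sum_divisors hN0, gamma0Index, Finsupp.prod, Nat.support_factorization]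
    refine Finset.prod_congr rfl fun p hp ↦ ?_
    have hp1 : N.factorization p = 1 :=
      Nat.factorization_eq_one_of_squarefree hN (Nat.prime_of_mem_primeFactors hp)
        (Nat.dvd_of_mem_primeFactors hp)
    rw [hp1]
    simp [Finset.sum_range_succ]
    ring
  · rintro ⟨c, j⟩ hx ⟨c', j'⟩ hx' hxx'
    simp only [Finset.coe_sigma, Set.mem_sigma_iff, Finset.mem_coe, Nat.mem_divisors,
      Finset.mem_range] at hx hx'
    obtain ⟨hcc, hjj⟩ := atkinLehner_coset_injective hN hx.1.1 hx'.1.1 hx.2 hx'.2 hxx'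
    subst hcc; subst hjj; rfl

end Cosets

/-! ### The coefficient sequence of the trace of a newform of squarefree level -/

section TraceCoefficients

variable {N : ℕ} [NeZero N]

/-- **The coefficients of the Rankin–Selberg trace of a newform of squarefree level**:
`rsCoeff N 2 f n = Σ_{c ∣ N, c ∣ n} (c/N) |a_{n/c}(f)|²` — the cusp `1/c` (width `N/c`) contributes
`N/c` cosets, each with period-`N` coefficients `|c_n| = 𝟙[c ∣ n] |a_{n/c}|/(N/c)` (Atkin–Lehner:
`f ∣ β(N/c) = ±(c/N) f(c·/N)`). For `c = N` this is the identity coset (`|a_{n/N}|²`), for `c = 1` the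
`N` Fricke cosets (`|a_n|²/N`, `IsNewform0.inv_le_rsCoeff_one`). [cite: Rankin1939, §4; AtkinLehner1970, Thm. 3] -/
theorem IsNewform0.rsCoeff_eq_sum_divisors_of_squarefree (hN : Squarefree N) {f : CuspForm (Gamma0 N) 2}
    (hf : IsNewform0 f) (n : ℕ) :
    rsCoeff N 2 f n = ∑ c ∈ N.divisors, if c ∣ n then (c : ℝ) / N * ‖cuspCoeff f (n / c)‖ ^ 2 else 0 := by
  classical
  haveI : Fintype (SL(2, ℤ) ⧸ Gamma0 N) := Fintype.ofFinite _
  have hN0 := hN.ne_zero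
  have hNr : (0 : ℝ) < N := Nat.cast_pos.mpr (NeZero.pos N)
  set term : SL(2, ℤ) ⧸ Gamma0 N → ℝ := fun r ↦
    ‖(qExpansion (N : ℝ) (⇑f ∣[(2 : ℤ)] (Quotient.out r)⁻¹)).coeff n‖ ^ 2 with hterm
  set ψ : (Σ _ : ℕ, ℕ) → SL(2, ℤ) ⧸ Gamma0 N := fun x ↦
    QuotientGroup.mk ((atkinLehnerSL N (N / x.1) * ModularGroup.T ^ (x.2 : ℤ))⁻¹) with hψ
  -- the value on each Atkin–Lehner coset
  have hval : ∀ c ∈ N.divisors, ∀ j : ℕ, term (ψ ⟨c, j⟩) =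
      if c ∣ n then ‖cuspCoeff f (n / c)‖ ^ 2 / (((N / c : ℕ) : ℝ)) ^ 2 else 0 := by
    intro c hc j
    have hcN : c ∣ N := Nat.dvd_of_mem_divisors hc
    have hc0 : 0 < c := Nat.pos_of_mem_divisors hc
    have hQ0 : 0 < N / c := Nat.div_pos (Nat.le_of_dvd (Nat.pos_of_ne_zero hN0) hcN) hc0
    haveI : NeZero (N / c) := ⟨hQ0.ne'⟩
    have hcQ : c * (N / c) = N := Nat.mul_div_cancel' hcN
    have hcop : Nat.Coprime (N / c) c := coprime_div_of_squarefree hN hcN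
    obtain ⟨ε, hε, -, hcoef, hzero⟩ := hf.exists_qExpansion_coeff_slash_atkinLehnerSL hcQ hcop
    obtain ⟨γ, hγ⟩ := QuotientGroup.mk_out_eq_mul (Gamma0 N)
      ((atkinLehnerSL N (N / c) * ModularGroup.T ^ (j : ℤ))⁻¹)
    have hout : (Quotient.out (ψ ⟨c, j⟩))⁻¹ = (γ : SL(2, ℤ))⁻¹ * (atkinLehnerSL N (N / c) * ModularGroup.T ^ (j : ℤ)) := by
      rw [hψ]
      dsimp only
      rw [hγ, mul_inv_rev, inv_inv]
    rw [hterm]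
    dsimp only
    rw [hout, SlashAction.slash_mul, slash_eq_self_of_mem_Gamma0 f (inv_mem γ.2),
      norm_qExpansion_coeff_slash_mul_T_zpow f (atkinLehnerSL N (N / c)) (j : ℤ) n]
    by_cases hcn : c ∣ n
    · rw [if_pos hcn]
      obtain ⟨m, rfl⟩ := hcn
      rw [hcoef m, Nat.mul_div_cancel_left _ hc0, norm_mul, norm_div, Complex.norm_natCast]
      have hε1 : ‖ε‖ = 1 := by rcases hε with h | h <;> simp [h]
      rw [hε1, mul_pow, div_pow, one_pow]
      ring
    · rw [if_neg hcn, hzero n hcn, norm_zero, zero_pow two_ne_zero]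
  -- sum over all cosets = sum over the Atkin–Lehner cosets
  have hinj : Set.InjOn ψ ((N.divisors.sigma fun c ↦ Finset.range (N / c)) : Set (Σ _ : ℕ, ℕ)) := by
    rintro ⟨c, j⟩ hx ⟨c', j'⟩ hx' hxx'
    simp only [Finset.coe_sigma, Set.mem_sigma_iff, Finset.mem_coe, Nat.mem_divisors,
      Finset.mem_range] at hx hx'
    obtain ⟨hcc, hjj⟩ := atkinLehner_coset_injective hN hx.1.1 hx'.1.1 hx.2 hx'.2 hxx'
    subst hcc; subst hjj; rfl
  rw [rsCoeff_eq_sum, ← image_atkinLehner_coset_eq_univ hN, Finset.sum_image hinj, Finset.sum_sigma]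
  refine Finset.sum_congr rfl fun c hc ↦ ?_
  have hcN : c ∣ N := Nat.dvd_of_mem_divisors hc
  have hc0 : 0 < c := Nat.pos_of_mem_divisors hc
  have hcr : (c : ℝ) ≠ 0 := by exact_mod_cast hc0.ne'
  have hQr : (((N / c : ℕ)) : ℝ) = (N : ℝ) / c := Nat.cast_div hcN hcr
  rw [Finset.sum_congr rfl fun j _ ↦ hval c hc j, Finset.sum_const, Finset.card_range, nsmul_eq_mul, hQr]
  by_cases hcn : c ∣ n
  · rw [if_pos hcn, if_pos hcn]
    field_simp
  · rw [if_neg hcn, if_neg hcn, mul_zero]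

/-- **The trace Dirichlet series of a newform of squarefree level is `P_N(w) · Σ |aₙ|² n^{-w}`**
with the finite Dirichlet polynomial `P_N(w) = N⁻¹ Σ_{c ∣ N} c^{1−w}` (real `w > 2`):
`Σₙ rsCoeff(n) n^{-w} = (N⁻¹ Σ_{c ∣ N} c^{1−w}) Σₘ |aₘ(f)|² m^{-w}`. In particular the completed
trace zeta function `Z_f` of `NewformPeterssonSizeSiegelProofs` is, for squarefree `N`, a
non-vanishing elementary factor times the continuation of the naive Rankin–Selberg series
`Σ |aₙ|² n^{-w}` of `f` itself (`= ζ⁽ᴺ⁾(w−1) L(Sym² f, w−1)/ζ⁽ᴺ⁾(2w−2)` up to the factors at `p ∣ N`).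
[cite: Rankin1939, §4] -/
theorem IsNewform0.tsum_rsCoeff_div_rpow_of_squarefree (hN : Squarefree N) {f : CuspForm (Gamma0 N) 2}
    (hf : IsNewform0 f) {w : ℝ} (hw : 2 < w) :
    ∑' n : ℕ, rsCoeff N 2 f n / (n : ℝ) ^ w =
      ((N : ℝ)⁻¹ * ∑ c ∈ N.divisors, (c : ℝ) ^ (1 - w)) * ∑' m : ℕ, ‖cuspCoeff f m‖ ^ 2 / (m : ℝ) ^ w := by
  have hN0 := hN.ne_zero
  have hNr : (0 : ℝ) < N := Nat.cast_pos.mpr (NeZero.pos N)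
  have hsum := summable_normSq_cuspCoeff_div_rpow f hw
  set D : ℝ := ∑' m : ℕ, ‖cuspCoeff f m‖ ^ 2 / (m : ℝ) ^ w with hD
  -- each divisor contributes `(c/N) c^{-w} D`
  have hc_term : ∀ c ∈ N.divisors, HasSum (fun n : ℕ ↦
      (if c ∣ n then (c : ℝ) / N * ‖cuspCoeff f (n / c)‖ ^ 2 else 0) / (n : ℝ) ^ w)
        ((c : ℝ) / N * (c : ℝ) ^ (-w) * D) := by
    intro c hc
    have hc0 : 0 < c := Nat.pos_of_mem_divisors hc
    have hcr : (0 : ℝ) < c := Nat.cast_pos.mpr hc0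
    -- reindex `n = c m`
    have hg : (fun m : ℕ ↦ (c : ℝ) / N * (c : ℝ) ^ (-w) * (‖cuspCoeff f m‖ ^ 2 / (m : ℝ) ^ w)) =
        fun m : ℕ ↦ (fun n : ℕ ↦ (if c ∣ n then (c : ℝ) / N * ‖cuspCoeff f (n / c)‖ ^ 2 else 0) /
          (n : ℝ) ^ w) (c * m) := by
      funext m
      simp only [Nat.dvd_mul_right, if_true, Nat.mul_div_cancel_left _ hc0]
      rw [Nat.cast_mul, Real.mul_rpow hcr.le (Nat.cast_nonneg m), Real.rpow_neg hcr.le]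
      field_simp
    have h1 : HasSum (fun m : ℕ ↦ (c : ℝ) / N * (c : ℝ) ^ (-w) * (‖cuspCoeff f m‖ ^ 2 / (m : ℝ) ^ w))
        ((c : ℝ) / N * (c : ℝ) ^ (-w) * D) := (hsum.hasSum).mul_left _
    rw [hg] at h1
    have hinj : Function.Injective (fun m : ℕ ↦ c * m) := mul_right_injective₀ hc0.ne'
    have hsupp : ∀ n ∉ Set.range (fun m : ℕ ↦ c * m),
        (if c ∣ n then (c : ℝ) / N * ‖cuspCoeff f (n / c)‖ ^ 2 else 0) / (n : ℝ) ^ w = 0 := by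
      intro n hn
      by_cases hcn : c ∣ n
      · obtain ⟨m, rfl⟩ := hcn; exact absurd ⟨m, rfl⟩ hn
      · rw [if_neg hcn, zero_div]
    exact (hinj.hasSum_iff hsupp).mp h1
  -- sum over the divisors
  have htot : HasSum (fun n : ℕ ↦ rsCoeff N 2 f n / (n : ℝ) ^ w)
      (∑ c ∈ N.divisors, (c : ℝ) / N * (c : ℝ) ^ (-w) * D) := by
    have h := hasSum_sum hc_term
    refine h.congr_fun fun n ↦ ?_
    rw [hf.rsCoeff_eq_sum_divisors_of_squarefree hN n, Finset.sum_div]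
  rw [htot.tsum_eq, Finset.mul_sum, Finset.sum_mul]
  refine Finset.sum_congr rfl fun c hc ↦ ?_
  have hcr : (0 : ℝ) < c := Nat.cast_pos.mpr (Nat.pos_of_mem_divisors hc)
  rw [show (1 : ℝ) - w = 1 + -w by ring, Real.rpow_add hcr, Real.rpow_one]
  field_simp

end TraceCoefficients

end Literature.NumberTheory.EllipticCurves.ModularForms
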